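import Literature.AlgebraicGeometry.Frobenioids.GeometricFrobenioidsThm62ivSchema
import Literature.AlgebraicGeometry.Frobenioids.GeometricFrobenioidModel
import Mathlib.FieldTheory.IsAlgClosed.AlgebraicClosure
import HarnessLib

/-!
# Frobenioids I, Theorem 6.2 (iv) AS TYPED (`Thm62iv`, F-1105): the "embedding" divisor data — automorphisms of
# `D` act freely on divisors, over ANY `K ⊆ K̃` — and the closure refuted MODULO the bare field datum (PROOF-ONLY)

Mochizuki, *The geometry of Frobenioids I: the general theory*, Kyushu J. Math. **62** (2008) 293–400, Example 6.1
p. 109, Theorem 6.2 (iv) p. 111, Def. 4.5 (iv) p. 86. [cite: MochizukiFrdI2008, Thm. 6.2 (iv) p.111]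
[cite: MochizukiFrdI2008, Ex. 6.1 p.109]

PROOF-ONLY sequel of `GeometricFrobenioidsThm62ivSchema.lean` (abc-iut cell, block F, seat abc-iut-f-045 gen 5; FROZEN
FACT-LIST row F-1105).  No `def`, no `instance`: the divisor data is built INSIDE a proof.
* `FinSubextCat.exists_algHom_comp_eq` — extension of `K`-embeddings into an algebraically closed `Ω` along the arrows of
  `D = FinSubextCat K Kt` (Mathlib's `IsAlgClosed.surjective_restrictDomain_of_isAlgebraic`).
* `GeometricDivisorData.exists_pullPhi_faithful` — for EVERY `K ⊆ Kt` there is geometric divisor data `Γ` AS TYPED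
  (`D_L := Hom_K(L, K̄)` with `K̄` an algebraic closure of `Kt`, prime-below = precomposition, all ramification indices `1`,
  `Φ(L) = ℤ_{≥0}[D_L]`, `B(L) = 1`) on which every endomorphism of an object of `D` fixing all divisors is the identity
  (`Aut_K(L)` acts freely on `Hom_K(L, K̄)`).  A degenerate inhabitant of the typed interface, not the divisor data of a
  variety.
* `not_forall_thm62iv_of_field` — hence the universal closure of F-1105 is refuted MODULO the bare field datum
  H_F1105' := "some FINITE `Kt/K` has an automorphism `z ≠ 1` fixing pointwise every intermediate field Galois over `K`"
  (in mathematics `ℚ(⁴√2)/ℚ`, `z : ⁴√2 ↦ −⁴√2` — not in the tree), through `not_thm62iv_of_faithful_of_trivial_on_galois`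
  at THE model `geomModelFrobenioid Γ` of abc-iut-L6-t10.
HONEST FRAMING: print's Thm. 6.2 (iv) is about Galois `K̃/K` and is PROVED in the tree at that strength (`Thm62iv_holds`);
nothing here bears on [IUTchIII] Cor. 3.12; no side taken; typed ≠ proved.
-/

noncomputable section

namespace Literature.AlgebraicGeometry.Frobenioids

open CategoryTheory

universe u v

namespace FinSubextCat

variable {K Kt : Type} [Field K] [Field Kt] [Algebra K Kt] {Ω : Type} [Field Ω] [Algebra K Ω] [IsAlgClosed Ω]

/-- **Embeddings extend along the arrows of `D`**: for `σ : Spec L → Spec M` (a `K`-algebra map `M → L` of finite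
subextensions) every `K`-embedding `M → Ω` into an algebraically closed `Ω` is the restriction of a `K`-embedding
`L → Ω` (`L` is algebraic over the image of `M`). [cite: MochizukiFrdI2008, Ex. 6.1 p.109] -/
theorem exists_algHom_comp_eq {X Y : FinSubextCat K Kt} (σ : Y ⟶ X) (P : X.L →ₐ[K] Ω) :
    ∃ Q : Y.L →ₐ[K] Ω, Q.comp σ.toAlgHom = P := by
  letI : Algebra X.L Y.L := σ.toAlgHom.toRingHom.toAlgebra
  haveI : IsScalarTower K X.L Y.L := IsScalarTower.of_algebraMap_eq fun k => (σ.toAlgHom.commutes k).symm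
  haveI : Algebra.IsAlgebraic X.L Y.L := Algebra.IsAlgebraic.tower_top (K := K) X.L
  obtain ⟨Q, hQ⟩ := IsAlgClosed.surjective_restrictDomain_of_isAlgebraic (K := K) (L := X.L) (M := Ω) (E := Y.L) P
  refine ⟨Q, ?_⟩
  ext a
  exact DFunLike.congr_fun hQ a

end FinSubextCat

namespace GeometricDivisorData

/-- **The "embedding" divisor data is faithful on automorphisms, over ANY `K ⊆ K̃`.**  There is geometric divisor data
`Γ` AS TYPED — `D_L := Hom_K(L, K̄)` (`K̄` an algebraic closure of `K̃`), prime-below = precomposition, ramification `1`,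
`Φ(L) = ℤ_{≥0}[D_L]`, `B(L) = 1` — such that an endomorphism `e` of `Spec L` with `e^* = id` on `Φ(L)` is the identity:
`e^*` moves the indicator divisor of the embedding `L ⊆ K̃ ⊆ K̄` unless `e = id` (embeddings are injective).
[cite: MochizukiFrdI2008, Ex. 6.1 p.109] -/
theorem exists_pullPhi_faithful (K Kt : Type) [Field K] [Field Kt] [Algebra K Kt] :
    ∃ Γ : GeometricDivisorData K Kt, ∀ (X : FinSubextCat K Kt) (e : X ⟶ X),
      (∀ y : Multiplicative (Γ.Phi X), Γ.pullPhi e y = y) → e = 𝟙 X := by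
  let Ω := AlgebraicClosure Kt
  let ι : Kt →ₐ[K] Ω := IsScalarTower.toAlgHom K Kt Ω
  let Γ : GeometricDivisorData K Kt :=
    { primeDiv := fun X => X.L →ₐ[K] Ω
      Phi := fun _ => ⊤
      B := fun _ => ⊥
      div := fun _ => 1
      over := fun σ Q => Q.comp σ.toAlgHom
      ram := fun _ _ => 1
      ram_pos := fun _ _ => Nat.one_pos
      over_finite := fun _ _ => Set.toFinite _
      over_surjective := fun σ P => FinSubextCat.exists_algHom_comp_eq σ P
      over_id := fun X Q => AlgHom.ext fun _ => rfl
      ram_id := fun _ _ => rfl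
      over_comp := fun τ σ Q => AlgHom.ext fun _ => rfl
      ram_comp := fun _ _ _ => rfl
      pull_mem := fun _ _ _ => AddSubmonoid.mem_top _
      map_mem := fun σ f hf => by
        rw [Subgroup.mem_bot] at hf
        rw [hf, map_one]
        exact Subgroup.one_mem _
      div_natural := fun σ f => by
        rw [MonoidHom.one_apply, MonoidHom.one_apply, toAdd_one, toAdd_one, map_zero]
      div_mem_gp := fun X f => ⟨0, AddSubmonoid.mem_top _, 0, AddSubmonoid.mem_top _, by
        rw [MonoidHom.one_apply, toAdd_one, sub_self]⟩
      qCartier := fun X P => ⟨1, Nat.one_pos, AddSubmonoid.mem_top _⟩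
      sub_mem := fun _ _ _ _ _ _ => AddSubmonoid.mem_top _
      primeDiv_nonempty := ⟨⟨⊥⟩, ⟨ι.comp (⊥ : IntermediateField K Kt).val⟩⟩ }
  refine ⟨Γ, fun X e he => ?_⟩
  -- the tautological embedding `Q₀ : L ⊆ K̃ ⊆ K̄` and its indicator divisor `[Q₀] ∈ Φ(L) = ℤ_{≥0}[D_L]`
  let Q₀ : X.L →ₐ[K] Ω := ι.comp X.L.val
  have hm : Finsupp.single Q₀ 1 ∈ Γ.Phi X := AddSubmonoid.mem_top _
  -- `e^* [Q₀] = [Q₀]`, coefficientwise: `[Q₀](Q ∘ e) = [Q₀](Q)`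
  have hD : ∀ Q : X.L →ₐ[K] Ω, Finsupp.single Q₀ 1 (Q.comp e.toAlgHom) = Finsupp.single Q₀ 1 Q := by
    intro Q
    have h2 : ((Multiplicative.toAdd (Γ.pullPhi e (Multiplicative.ofAdd ⟨Finsupp.single Q₀ 1, hm⟩)) : Γ.Phi X) :
          (X.L →ₐ[K] Ω) →₀ ℕ) Q = Finsupp.single Q₀ 1 Q :=
      congrArg (fun y : Multiplicative (Γ.Phi X) => ((Multiplicative.toAdd y : Γ.Phi X) : (X.L →ₐ[K] Ω) →₀ ℕ) Q)
        (he (Multiplicative.ofAdd ⟨Finsupp.single Q₀ 1, hm⟩))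
    rw [GeometricDivisorData.coe_toAdd_pullPhi, GeometricDivisorData.pull_apply] at h2
    change 1 * Finsupp.single Q₀ 1 (Q.comp e.toAlgHom) = Finsupp.single Q₀ 1 Q at h2
    rwa [one_mul] at h2
  -- at `Q := Q₀`: `Q₀ ∘ e = Q₀`
  have hQ₀ : Q₀.comp e.toAlgHom = Q₀ := by
    classical
    have h1 := hD Q₀
    rw [Finsupp.single_eq_same] at h1
    by_contra hne
    rw [Finsupp.single_apply, if_neg (Ne.symm hne)] at h1
    exact zero_ne_one h1
  -- `Q₀` is injective, so `e = id`
  apply FinSubextCat.hom_ext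
  exact AlgHom.ext fun a => Q₀.toRingHom.injective (DFunLike.congr_fun hQ₀ a)

end GeometricDivisorData

/-! ### F-1105: the closure refuted MODULO the bare field datum -/

/-- **F-1105 (`Thm62iv`) — universal closure REFUTED MODULO the field datum H_F1105'**: if some FINITE extension `Kt/K`
has an automorphism `z ≠ 1` fixing pointwise every intermediate field that is Galois over `K` (mathematics: `ℚ(⁴√2)/ℚ`;
not in the tree), then `∀ …, Thm62iv M` fails — at THE model `geomModelFrobenioid Γ` of the embedding divisor data
`Γ` of `exists_pullPhi_faithful`, by `not_thm62iv_of_faithful_of_trivial_on_galois`.  Print's Thm. 6.2 (iv) (Galois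
`K̃/K`, `Thm62iv_holds`) is untouched. [cite: MochizukiFrdI2008, Thm. 6.2 (iv) p.111] -/
theorem not_forall_thm62iv_of_field
    (H : ∃ (K Kt : Type) (_ : Field K) (_ : Field Kt) (_ : Algebra K Kt) (_ : FiniteDimensional K Kt)
      (z : Kt ≃ₐ[K] Kt), z ≠ 1 ∧ ∀ E : IntermediateField K Kt, IsGalois K E → ∀ x : Kt, x ∈ E → z x = x) :
    ¬ ∀ (K : Type) (_ : Field K) (Kt : Type) (_ : Field Kt) (_ : Algebra K Kt) (Γ : GeometricDivisorData K Kt)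
        (C : Type) (_ : Category.{0} C) (M : GeometricModelFrobenioid Γ C), Thm62iv M := by
  obtain ⟨K, Kt, _, _, _, _, z, hz1, htriv⟩ := H
  obtain ⟨Γ, hΓ⟩ := GeometricDivisorData.exists_pullPhi_faithful K Kt
  refine not_forall_thm62iv_of ⟨K, Kt, _, _, _, inferInstance, Γ, geomFrobenioid Γ, inferInstance,
    geomModelFrobenioid Γ, fun X e _ he => hΓ X e fun y => ?_, z, hz1, htriv⟩
  -- `M.ops.pull = Γ.pullPhi` for THE model (`monEquiv = refl`, `monEquiv_natural = rfl`)
  exact he y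

end Literature.AlgebraicGeometry.Frobenioids

end
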